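import Summits.NavierStokesRegularity.FunctionalMining.BiaxialEikonalSpectrum
import HarnessLib

/-!
# FunctionalMining — CONTACT FERMAT: where a fixed unit direction attains the top value `M ≥ λ₁` or the
# bottom value `−2M ≤ λ₃` of the strain's Rayleigh quotient, the axis–axis strain component is critical
# (the one-line step of `SIEVELD.md` §3.4b (4d) Part A, every field, `card d = 3`)

Search for candidate a priori estimates; no regularity claim. Cell `pub-nsfunc`, prove seat (gen 20).
Static calculus of smooth fields on the flat torus; nothing about Navier–Stokes dynamics.

SIEVELD §3.4b (4d) Part A argues: with `λ₁ ≡ 1` and `tr S = 0` one has `λ₃ ≥ −2` everywhere, so at a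
biaxial point `y` with bottom axis `n₀` the `C¹` function `f(x) := n₀ᵀ S(x) n₀ ≥ −2` has a global minimum
`f(y) = −2`, whence `∇f(y) = 0`. This file isolates that step for an ARBITRARY smooth divergence-free field
and a uniform bound `λ₁ ≤ M` (no zero-cost structure needed):
* `quadStrain_le_top`, `neg_two_mul_top_le_quadStrain`: for a unit `e`,
  `−2λ₁(x) ≤ eᵀ S(v)(x) e ≤ λ₁(x)` (`card d = 3`, divergence free: `λ₃ = −λ₁ − λ₂ ≥ −2λ₁`).
* **`partialDeriv_quadStrain_eq_zero_of_bottom_contact`**: if `λ₁ ≤ M` everywhere and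
  `eᵀS(v)(y)e = −2M` (a bottom contact: `y` is then biaxial with axis `e` and `λ₁(y) = M`), then
  `∂ₖ(eᵀ S(v) e)(y) = 0` for every `k`; **`…_of_top_contact`**: the same where `eᵀS(v)(y)e = M`.
Tools: Fermat on the torus (`partialDeriv_eq_zero_of_forall_le`), the Rayleigh sup `TopEig.lam`
(`quad_le_lam`, `lam_strainFlat`, `lam_neg_strainFlat`). [ours = assembly; folklore = Fermat/Rayleigh]
-/

noncomputable section

open MeasureTheory Set Filter Topology

namespace Summit.NavierStokesRegularity.FunctionalMining
open Literature.Analysis Literature.Analysis.FunctionSpaces Literature.Analysis.FunctionSpaces.Torus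
  Literature.Analysis.FluidPDE TopEig

namespace BiaxialEikonal

variable {d : Type*} [Fintype d] [DecidableEq d]

/-- The Rayleigh form of the strain in matrix terms: `quad (strainFlat v x) e = ∑ᵢⱼ eᵢ S(v)(x)ᵢⱼ eⱼ`.
[ours; bookkeeping] -/
theorem quad_strainFlat_eq (v : UnitAddTorus d → EuclideanSpace ℝ d) (x : UnitAddTorus d) (e : d → ℝ) :
    quad (StrainL4.strainFlat v x) e = ∑ i, ∑ j, e i * torusStrainMatrix v x i j * e j := by
  simp only [quad, StrainL4.strainFlat_apply, torusStrainMatrix_apply]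

/-- `eᵀ S(v)(x) e ≤ λ₁(x)` for a unit vector `e`. [folklore] -/
theorem quadStrain_le_top [Nonempty d] (v : UnitAddTorus d → EuclideanSpace ℝ d) (x : UnitAddTorus d)
    {e : d → ℝ} (he : e ⬝ᵥ e = 1) :
    ∑ i, ∑ j, e i * torusStrainMatrix v x i j * e j ≤ torusStrainTopEig v x := by
  rw [← quad_strainFlat_eq, ← lam_strainFlat]
  exact quad_le_lam _ he

/-- `λ₃(x) ≤ eᵀ S(v)(x) e` for a unit vector `e`. [folklore] -/
theorem bot_le_quadStrain [Nonempty d] (v : UnitAddTorus d → EuclideanSpace ℝ d) (x : UnitAddTorus d)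
    {e : d → ℝ} (he : e ⬝ᵥ e = 1) :
    torusStrainBotEig v x ≤ ∑ i, ∑ j, e i * torusStrainMatrix v x i j * e j := by
  have h := quad_le_lam (-StrainL4.strainFlat v x) he
  rw [lam_neg_strainFlat, show -StrainL4.strainFlat v x = (-1 : ℝ) • StrainL4.strainFlat v x by simp,
    quad_smul, quad_strainFlat_eq] at h
  linarith

/-- **`λ₃ ≥ −2λ₁`** for smooth divergence-free fields at `card d = 3` (`λ₁ + λ₂ + λ₃ = 0`, `λ₂ ≤ λ₁`).
[folklore] -/
theorem neg_two_mul_top_le_bot (hd : Fintype.card d = 3) {v : UnitAddTorus d → EuclideanSpace ℝ d}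
    (hv : Torus.IsSmooth v) (hdiv : Torus.IsDivFree v) (x : UnitAddTorus d) :
    -2 * torusStrainTopEig v x ≤ torusStrainBotEig v x := by
  set e := torusStrainEig v x with he'
  set f : Fin 3 → ℝ := fun j => e (Fin.cast hd.symm j) with hfdef
  have hf : Antitone f := fun a b hab =>
    torusStrainEig_antitone v x (show Fin.cast hd.symm a ≤ Fin.cast hd.symm b by simpa using hab)
  have hsume : ∑ j, f j = ∑ k', e k' :=
    Fintype.sum_equiv (finCongr hd.symm) f e (fun j => rfl)
  have hsum3 : f 0 + f 1 + f 2 = 0 := by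
    rw [← Fin.sum_univ_three, hsume, he', sum_torusStrainEig_eq_zero hv hdiv x]
  have htop : torusStrainTopEig v x = f 0 := by
    unfold torusStrainTopEig
    rw [← he', ← (finCongr hd.symm).iSup_comp]
    change (⨆ j, f j) = f 0
    exact TopEig.iSup_eq_apply_zero_of_antitone (by norm_num) hf
  have hbot : torusStrainBotEig v x = f 2 := by
    unfold torusStrainBotEig
    rw [← he', ← (finCongr hd.symm).iInf_comp]
    change (⨅ j, f j) = f 2
    exact le_antisymm (ciInf_le (Set.finite_range f).bddBelow 2) (le_ciInf fun j => hf (Fin.le_last j))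
  have h01 : f 1 ≤ f 0 := hf (by decide)
  rw [htop, hbot]
  linarith

/-- `−2λ₁(x) ≤ eᵀ S(v)(x) e` for a unit `e` (divergence free, `card d = 3`). [folklore] -/
theorem neg_two_mul_top_le_quadStrain (hd : Fintype.card d = 3) {v : UnitAddTorus d → EuclideanSpace ℝ d}
    (hv : Torus.IsSmooth v) (hdiv : Torus.IsDivFree v) (x : UnitAddTorus d) {e : d → ℝ} (he : e ⬝ᵥ e = 1) :
    -2 * torusStrainTopEig v x ≤ ∑ i, ∑ j, e i * torusStrainMatrix v x i j * e j := by
  haveI : Nonempty d := Fintype.card_pos_iff.mp (by omega)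
  exact (neg_two_mul_top_le_bot hd hv hdiv x).trans (bot_le_quadStrain v x he)

/-- **CONTACT FERMAT, BOTTOM (the step of SIEVELD §3.4b (4d) Part A).** Let `v` be smooth and divergence
free on `T³` (`card d = 3`) with `λ₁(S(v)) ≤ M` everywhere, and let a unit vector `e` attain the bottom
value `eᵀ S(v)(y) e = −2M` at `y` (so `y` is a biaxial point with bottom axis `e` and `λ₁(y) = λ₂(y) = M`).
Then the axis–axis component `x ↦ eᵀ S(v)(x) e` has a global minimum at `y` and all its partial
derivatives vanish there. [ours] -/
theorem partialDeriv_quadStrain_eq_zero_of_bottom_contact (hd : Fintype.card d = 3)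
    {v : UnitAddTorus d → EuclideanSpace ℝ d} (hv : Torus.IsSmooth v) (hdiv : Torus.IsDivFree v)
    {M : ℝ} (hM : ∀ x, torusStrainTopEig v x ≤ M) {e : d → ℝ} (he : e ⬝ᵥ e = 1) {y : UnitAddTorus d}
    (hy : ∑ i, ∑ j, e i * torusStrainMatrix v y i j * e j = -2 * M) (k : d) :
    Torus.partialDeriv k (fun x => ∑ i, ∑ j, e i * torusStrainMatrix v x i j * e j) y = 0 := by
  have hmin : ∀ x, -(∑ i, ∑ j, e i * torusStrainMatrix v x i j * e j) ≤
      -(∑ i, ∑ j, e i * torusStrainMatrix v y i j * e j) := by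
    intro x
    have h1 := neg_two_mul_top_le_quadStrain hd hv hdiv x he
    have h2 := hM x
    rw [hy]
    linarith
  have h := partialDeriv_eq_zero_of_forall_le (f := fun x => -(∑ i, ∑ j, e i * torusStrainMatrix v x i j * e j))
    hmin k
  rw [partialDeriv_neg] at h
  exact neg_eq_zero.mp h

/-- **CONTACT FERMAT, TOP.** If `λ₁(S(v)) ≤ M` everywhere and a unit `e` attains `eᵀ S(v)(y) e = M`, then
all partial derivatives of `x ↦ eᵀ S(v)(x) e` vanish at `y`. (Any smooth `v`, any `d`.) [ours] -/
theorem partialDeriv_quadStrain_eq_zero_of_top_contact [Nonempty d]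
    {v : UnitAddTorus d → EuclideanSpace ℝ d} {M : ℝ} (hM : ∀ x, torusStrainTopEig v x ≤ M)
    {e : d → ℝ} (he : e ⬝ᵥ e = 1) {y : UnitAddTorus d}
    (hy : ∑ i, ∑ j, e i * torusStrainMatrix v y i j * e j = M) (k : d) :
    Torus.partialDeriv k (fun x => ∑ i, ∑ j, e i * torusStrainMatrix v x i j * e j) y = 0 := by
  refine partialDeriv_eq_zero_of_forall_le (fun x => ?_) k
  rw [hy]
  exact (quadStrain_le_top v x he).trans (hM x)

/-- First partials of a strain entry: `∂ₖ S(v)ᵢⱼ = ½((∂ₖ∂ⱼv)ᵢ + (∂ₖ∂ᵢv)ⱼ)`. [folklore] -/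
theorem partialDeriv_strain_entry {v : UnitAddTorus d → EuclideanSpace ℝ d} (hv : Torus.IsSmooth v)
    (k i j : d) (y : UnitAddTorus d) :
    Torus.partialDeriv k (fun x => torusStrainMatrix v x i j) y =
      (Torus.partialDeriv k (Torus.partialDeriv j v) y i + Torus.partialDeriv k (Torus.partialDeriv i v) y j) / 2 := by
  have hc : ∀ l m : d, Torus.IsContDiff 1 (fun x => Torus.partialDeriv l v x m) :=
    fun l m => ((hv.partialDeriv l).apply m).isContDiff (by simp)
  have hfun : (fun x => torusStrainMatrix v x i j) =
      (1 / 2 : ℝ) • ((fun x => Torus.partialDeriv j v x i) + fun x => Torus.partialDeriv i v x j) := by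
    funext x
    simp only [torusStrainMatrix_apply, Pi.smul_apply, Pi.add_apply, smul_eq_mul]
    ring
  rw [hfun, partialDeriv_const_smul ((hc j i).add (hc i j)), Pi.smul_apply, partialDeriv_add (hc j i) (hc i j),
    Pi.add_apply, smul_eq_mul, partialDeriv_apply_coord ((hv.partialDeriv j).isContDiff (by simp)),
    partialDeriv_apply_coord ((hv.partialDeriv i).isContDiff (by simp))]
  ring

/-- The axis–axis component in derivatives of `v`: `∂ₖ(eᵀ S(v) e) = ∑ᵢⱼ eᵢeⱼ (∂ₖ∂ⱼ v)ᵢ` (so the contact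
conditions above are linear conditions on the second derivatives of `v` at `y`). [folklore] -/
theorem partialDeriv_quadStrain {v : UnitAddTorus d → EuclideanSpace ℝ d} (hv : Torus.IsSmooth v)
    (e : d → ℝ) (k : d) (y : UnitAddTorus d) :
    Torus.partialDeriv k (fun x => ∑ i, ∑ j, e i * torusStrainMatrix v x i j * e j) y =
      ∑ i, ∑ j, e i * e j * Torus.partialDeriv k (Torus.partialDeriv j v) y i := by
  have hS1 : ∀ i j, Torus.IsContDiff 1 (fun x => torusStrainMatrix v x i j) := by
    intro i j
    have h : Torus.IsSmooth (fun x => Torus.partialDeriv j v x i + Torus.partialDeriv i v x j) :=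
      ((hv.partialDeriv j).apply i).add ((hv.partialDeriv i).apply j)
    have h2 : Torus.IsSmooth (fun x => torusStrainMatrix v x i j) := by
      have e1 : (fun x => torusStrainMatrix v x i j) =
          (1 / 2 : ℝ) • fun x => Torus.partialDeriv j v x i + Torus.partialDeriv i v x j := by
        funext x; simp only [torusStrainMatrix_apply, Pi.smul_apply, smul_eq_mul]; ring
      rw [e1]; exact h.smul (1 / 2)
    exact h2.isContDiff (by simp)
  have hc : ∀ i j, Torus.IsContDiff 1 (fun x => e i * torusStrainMatrix v x i j * e j) :=
    fun i j => ContDiff.mul (ContDiff.mul contDiff_const (hS1 i j)) contDiff_const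
  have hterm : ∀ i j, Torus.partialDeriv k (fun x => e i * torusStrainMatrix v x i j * e j) y =
      e i * e j * ((Torus.partialDeriv k (Torus.partialDeriv j v) y i
        + Torus.partialDeriv k (Torus.partialDeriv i v) y j) / 2) := by
    intro i j
    rw [show (fun x => e i * torusStrainMatrix v x i j * e j) = (e i * e j) • fun x => torusStrainMatrix v x i j
        from funext fun x => by simp only [Pi.smul_apply, smul_eq_mul]; ring,
      partialDeriv_const_smul (hS1 i j), Pi.smul_apply, smul_eq_mul, partialDeriv_strain_entry hv]
  have hrow : ∀ i, Torus.IsContDiff 1 (fun x => ∑ j, e i * torusStrainMatrix v x i j * e j) :=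
    fun i => ContDiff.sum fun j _ => hc i j
  rw [partialDeriv_finset_sum _ (fun i _ => hrow i)]
  simp only [partialDeriv_finset_sum _ (fun j _ => hc _ j), hterm]
  -- symmetrise: `∑ᵢⱼ eᵢeⱼ (Aᵢⱼ + Aⱼᵢ)/2 = ∑ᵢⱼ eᵢeⱼ Aᵢⱼ`
  have hsymm : ∑ i, ∑ j, e i * e j * Torus.partialDeriv k (Torus.partialDeriv i v) y j =
      ∑ i, ∑ j, e i * e j * Torus.partialDeriv k (Torus.partialDeriv j v) y i := by
    rw [Finset.sum_comm]
    exact Finset.sum_congr rfl fun i _ => Finset.sum_congr rfl fun j _ => by ring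
  have hsplit : ∑ i, ∑ j, e i * e j * ((Torus.partialDeriv k (Torus.partialDeriv j v) y i
      + Torus.partialDeriv k (Torus.partialDeriv i v) y j) / 2) =
      (∑ i, ∑ j, e i * e j * Torus.partialDeriv k (Torus.partialDeriv j v) y i) / 2
        + (∑ i, ∑ j, e i * e j * Torus.partialDeriv k (Torus.partialDeriv i v) y j) / 2 := by
    rw [Finset.sum_div, Finset.sum_div, ← Finset.sum_add_distrib]
    refine Finset.sum_congr rfl fun i _ => ?_
    rw [Finset.sum_div, Finset.sum_div, ← Finset.sum_add_distrib]
    exact Finset.sum_congr rfl fun j _ => by ring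
  rw [hsplit, hsymm]
  ring

end BiaxialEikonal

end Summit.NavierStokesRegularity.FunctionalMining

end
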